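import Summits.ABC.IUTFork.Joshi.ArithmeticoidProperties

/-!
# [J-2½] §2.3 / Def. 5.1.1 / Def. 5.2.1 — ADDENDA to `Joshi/Arithmeticoids.lean`: the valuation-topology compatibility predicate
# (a self-located gap of the signature), the value group is a group, topological equivalence is an equivalence relation

Proof/definition addendum of the abc-iut cell, branch E (rung LADDER-ABC:A2.E; seat abc-iut-E-t37, author of `ATS2h.DeformationDatum`,
p430482). Same source and conventions: [J-2½] = K. Joshi, arXiv:2305.10398 (lit key `paper:arxiv-2305.10398`, bib `Joshi2023ATS2half`,
«p.N l.M» = line M of `HOME/plan/repair/lit/renders/Joshi-arxiv-2305.10398-ATS2half/pNNNN.txt`). TAKES NO SIDE on [IUTchIII] Cor. 3.12, on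
Joshi's claims, or on Mochizuki's reports on them; typed ≠ proved; nothing is asserted.

1. SELF-LOCATED GAP, made explicit. In `DeformationDatum L V Lv Y K G A` the topology of each residue field `K_y` is a PARAMETER
   (`[∀ v y, TopologicalSpace (K v y)]`) and the valuation `|−|_{K_y}` is a FIELD (`absK`, a Bourbaki valued field, §2.3), with no field tying
   the two; print's `K_y` is a valued field topologised BY its valuation (§2.3 p.11 l.33 – p.12 l.6: «(ℂ, |−|_ℂ) is a Banach field i.e. `|−|_ℂ`
   is a norm on `ℂ` with respect to which `ℂ` is complete»; Def. 5.2.1's «topologically isomorphic» arithmetic rings, p.31 l.44–45, and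
   Thm. 5.5.2 (7)'s non-homeomorphic residue fields [Kedlaya–Temkin 2018], p.35 l.21–33, refer to that topology). The predicate
   `DeformationDatum.IsValuationTopology` states the compatibility (open sets = unions of `|−|_{K_y}`-balls); consumers of `TopEquivalent` /
   `Thm552_7` / `LocalTopInequivalent` (this seat's files, seat T-38's `ArithmeticoidBridgeATS2h`, seat T-05's `HolomorphoidsOfDeformation`,
   seat E-t46's `Arithmeticoids2`) may take it as an explicit hypothesis where print's topology is meant. The toy model `toyDatum`
   (`Joshi/ArithmeticoidsToyModel.lean`) does NOT satisfy it (its `RatFunc ℚ` carries Mathlib's `X`-adic `Valued` topology, its `degAbs` is the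
   place at infinity) — the toy certifies joint satisfiability of the 28 fields only, as its docstring says.
2. `valueGroup` (Props. 4.7.2 (2) / 4.8.3 (2), Def. 5.14.2) is a subgroup of `(ℝ_{>0}, ·)`: `one_mem_valueGroup`, `mul_mem_valueGroup`,
   `inv_mem_valueGroup`, `valueGroup_pos` — DERIVED from `IsValuedField`.
3. Def. 5.2.1 `TopEquivalent` is an equivalence relation: `TopEquivalent.symm`, `TopEquivalent.trans` (with `.refl` of p430871) — DERIVED.
-/

noncomputable section

open TopologicalSpace

namespace Summit.ABC.IUTFork.Joshi.ATS2h

namespace DeformationDatum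

variable {L : Type} [Field L] {V : Type} {Lv : V → Type} [∀ v, Field (Lv v)] {Y : V → Type}
  [∀ v, TopologicalSpace (Y v)] {K : (v : V) → Y v → Type} [∀ v y, Field (K v y)] [∀ v y, TopologicalSpace (K v y)]
  {G : V → Type} [∀ v, Group (G v)] {A : V → Type} [∀ v, Group (A v)]
  (D : DeformationDatum L V Lv Y K G A)

/-! ## 1. The valuation topology on the residue fields (§2.3; Def. 5.2.1) -/

/-- The open `|−|_{K_y}`-ball of radius `ε` about `x`. [folklore] -/
def ball (v : V) (y : Y v) (x : K v y) (ε : ℝ) : Set (K v y) := {z | D.absK v y (z - x) < ε}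

/-- **Compatibility of the carried topology of `K_y` with its valuation** (§2.3 p.11 l.33 – p.12 l.6; the topology Def. 5.2.1 and
Thm. 5.5.2 (7) refer to): a set is open iff it contains a `|−|_{K_y}`-ball about each of its points. NOT a field of `DeformationDatum` (a
self-located gap of the signature of p430482); an explicit hypothesis for consumers that need print's topology. OUR READING.
[claim: Joshi2023ATS2half, status: disputed] -/
def IsValuationTopology : Prop :=
  ∀ (v : V) (y : Y v) (s : Set (K v y)), IsOpen s ↔ ∀ x ∈ s, ∃ ε : ℝ, 0 < ε ∧ D.ball v y x ε ⊆ s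

/-- `x` lies in every `|−|_{K_y}`-ball of positive radius about `x` (`|0|_{K_y} = 0`). [folklore] -/
theorem mem_ball_self (v : V) (y : Y v) (x : K v y) {ε : ℝ} (hε : 0 < ε) : x ∈ D.ball v y x ε := by
  simp only [ball, Set.mem_setOf_eq, sub_self, ((D.absK_isValuedField v y).eq_zero_iff 0).2 rfl]
  exact hε

/-! ## 2. The value group is a group (Props. 4.7.2 (2) / 4.8.3 (2); Def. 5.14.2) -/

/-- Every element of the value group is positive. [folklore] -/
theorem valueGroup_pos (v : V) (y : Y v) {r : ℝ} (hr : r ∈ D.valueGroup v y) : 0 < r := by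
  obtain ⟨x, hx, rfl⟩ := hr
  exact (D.absK_isValuedField v y).pos_of_ne_zero hx

/-- `1 = |1|` lies in the value group. [folklore] -/
theorem one_mem_valueGroup (v : V) (y : Y v) : (1 : ℝ) ∈ D.valueGroup v y :=
  ⟨1, one_ne_zero, (D.absK_isValuedField v y).map_one⟩

/-- The value group is closed under multiplication (`|x|·|x′| = |x·x′|`). [folklore] -/
theorem mul_mem_valueGroup (v : V) (y : Y v) {r s : ℝ} (hr : r ∈ D.valueGroup v y) (hs : s ∈ D.valueGroup v y) :
    r * s ∈ D.valueGroup v y := by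
  obtain ⟨x, hx, rfl⟩ := hr
  obtain ⟨x', hx', rfl⟩ := hs
  exact ⟨x * x', mul_ne_zero hx hx', (D.absK_isValuedField v y).map_mul x x'⟩

/-- The value group is closed under inversion (`|x|⁻¹ = |x⁻¹|`). [folklore] -/
theorem inv_mem_valueGroup (v : V) (y : Y v) {r : ℝ} (hr : r ∈ D.valueGroup v y) : r⁻¹ ∈ D.valueGroup v y := by
  obtain ⟨x, hx, rfl⟩ := hr
  exact ⟨x⁻¹, inv_ne_zero hx, (D.absK_isValuedField v y).map_inv x⟩

/-- The value group is non-trivial (`(K_y, |−|_{K_y})` is non-trivially valued, §2.3 p.11 l.43–45). [folklore] -/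
theorem exists_mem_valueGroup_ne_one (v : V) (y : Y v) : ∃ r ∈ D.valueGroup v y, r ≠ 1 := by
  obtain ⟨x, hx, h1⟩ := (D.absK_isValuedField v y).nontrivial
  exact ⟨D.absK v y x, ⟨x, hx, rfl⟩, h1⟩

/-! ## 3. Def. 5.2.1: topological equivalence is an equivalence relation -/

/-- Topological equivalence is symmetric. [folklore] -/
theorem TopEquivalent.symm {y₁ y₂ : D.Arith} (h : D.TopEquivalent y₁ y₂) : D.TopEquivalent y₂ y₁ := by
  obtain ⟨e, he, he'⟩ := h
  exact ⟨e.symm, he', by simpa using he⟩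

/-- Topological equivalence is transitive. [folklore] -/
theorem TopEquivalent.trans {y₁ y₂ y₃ : D.Arith} (h : D.TopEquivalent y₁ y₂) (h' : D.TopEquivalent y₂ y₃) :
    D.TopEquivalent y₁ y₃ := by
  obtain ⟨e, he, he'⟩ := h
  obtain ⟨f, hf, hf'⟩ := h'
  exact ⟨e.trans f, hf.comp he, he'.comp hf'⟩

/-- Hence Thm. 5.5.2 (7)'s witnesses may be taken in either order. [folklore] -/
theorem thm552_7_symm_iff : D.Thm552_7 ↔ ∃ y₁ y₂ : D.Arith, ¬ D.TopEquivalent y₂ y₁ :=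
  ⟨fun ⟨y₁, y₂, h⟩ => ⟨y₁, y₂, fun h' => h (TopEquivalent.symm D h')⟩,
    fun ⟨y₁, y₂, h⟩ => ⟨y₁, y₂, fun h' => h (TopEquivalent.symm D h')⟩⟩

end DeformationDatum

end Summit.ABC.IUTFork.Joshi.ATS2h
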